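import Summits.BirchSwinnertonDyer.Rank1Residual.Additive.TwistPartnerForcedDichotomy
import Summits.BirchSwinnertonDyer.Rank1Residual.Additive.TwistPartnerForcedOfDelbourgo
import Summits.BirchSwinnertonDyer.Rank1Residual.Supersingular.SharpFlatNonvanishing
import HarnessLib

/-!
# The conjugate forced partners: EXACTLY ONE is tower-bounded under Delbourgo 1998 Thm. 1 — the
# per-pair SIGN BIT of the defect-3/4/6 tame-branch route is DECIDABLE and the sign certificate is
# COMPLETE (cell `b2b-bsdres`, sub-cell additive-p2 = X3♯(G-ord)/X4♯(G-ord), gen 26)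

HONEST FRAMING (cell `b2b-bsdres`, run/shared/lean/b2b/bsd-rank1-residual/, verbatim in every
file): the goal of the cell is to DELETE the COMBINATION-SHAPED residual classes of the
Birch–Swinnerton-Dyer formula for ALL analytic-rank `≤ 1` elliptic curves over `ℚ` — "full BSD
formula for every rank `≤ 1` curve in class `C`" assembled STRICTLY from published theorems — so
that the rank-`≤ 1` remainder becomes exactly the CONSTRUCTION-SHAPED classes, which are TYPED
(missing-input `Prop`s), NOT attempted. This is not "finishing BSD". Sub-cell additive-p2: the
classes X3♯(G-ord) / X4♯(G-ord) are CONSTRUCTION-SHAPED and stay so; labels / RESIDUAL-MAP marks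
UNCHANGED; nothing is booked. Theorems only; the one named fact enters as a hypothesis binder
(`Delbourgo1998.thm1_exists_bounded_evenMeasure`, A282). No definition, no `sorry`.

## What

Continuation of `TwistPartnerForcedDichotomy` (at most one of the conjugate forced partners
`(χ, ã)`, `(χ⁻¹, ã)` is tower-bounded, given a non-vanishing datum). Here, with Delbourgo 1998
Thm. 1 on the (G)-ordinary ADDITIVE locus, `p ≥ 5`, defect `e ∈ {3,4,6}`, `χ` of order `e`, `ã` THE
unit root of `X² − a_w(E_F)X + p` at a (G)-place:

* §2 **EXISTENCE** `towerBounded_forced_or_inv_of_thm1`: one of the two is tower-bounded (the fact's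
  pair `(ε, α_p)` has `α_p = ã` and `ε ∈ {χ, χ⁻¹}`, `φ(e) = 2`). **EXACTLY ONE**
  `towerBounded_forced_iff_not_inv_of_thm1` (with a non-vanishing datum: `[0]⁺_f ≠ 0`, or one
  non-vanishing even wild twisted symbol sum). **THE SIGN CERTIFICATE IS SUFFICIENT AND NECESSARY**
  `towerBounded_forced_iff_exists_signCert_of_thm1` (⟸ gen 25; ⟹ the fact-free half): gen 25's three
  finite per-pair data are COMPLETE. **THE SIGN BIT IS DECIDABLE**
  `exists_signCert_iff_not_exists_signCert_inv_of_thm1`: of the two candidate sign certificates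
  (against `χ⁻¹`, against `χ`) EXACTLY ONE exists — the census's two-sided tower search (E-SIGNCERT,
  gen 25: 13/13 window rows) TERMINATES and CANNOT ANSWER BOTH WAYS.
* §3 `ord_{s=1}L(E,s) = 0` (census arm X4-3): the non-vanishing datum is automatic (`[0]⁺_f ≠ 0`,
  the tree's `Supersingular.ratPlusSymbol_zero_ne_zero_of_analyticRank_eq_zero`), so
  on X4♯(G-ord) ∩ {e ∈ {3,4,6}} ∩ {r_an = 0} the sign bit is decidable with NO extra input
  (`ClassX4Gord.exists_signCert_iff_not_exists_signCert_inv_rankZero_of_thm1`, Drinfeld–Manin bound `1`;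
  `ClassX4Gord.towerBounded_forced_iff_not_inv_rankZero_of_thm1`).

Not claimed: WHICH character is bounded (print decides it by ordinarity of `f ⊗ ε̄`, not by a
formula; census dictionary `ω^{t(E,p)}` = EVIDENCE); anything at `L(E,1) = 0` without a non-vanishing
twisted value (Rohrlich's theorem at `p ∣ N` is not a tree object). Nothing booked.

References: Delbourgo, Compositio Math. 113 (1998) Thm. 1, p. 130, pp. 132–133 [Delbourgo1998];
Mazur–Tate–Teitelbaum, Invent. Math. 84 (1986) §I.8, §I.10–I.14 [MazurTateTeitelbaum1986Invent];
Manin 1972 Cor. 3.6 [Manin1972]. -/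

noncomputable section

open scoped Classical MatrixGroups ModularForm NumberField

open CongruenceSubgroup IsDedekindDomain WeierstrassCurve NumberField
  Literature.NumberTheory.EllipticCurves
  Literature.NumberTheory.EllipticCurves.ModularForms
  Literature.NumberTheory.EllipticCurves.Rank1Residual

namespace Summit.BirchSwinnertonDyer.Rank1Residual.Additive

namespace TwistPartner

/-! ### §2 Exactly one, from Delbourgo 1998 Theorem 1; the sign bit is decidable -/

section ExactlyOne

variable {W : WeierstrassCurve ℚ} [W.IsElliptic] [W.IsGloballyMinimal] {p : ℕ} [hp : Fact p.Prime]
  {N : ℕ} [NeZero N] {f : CuspForm (Gamma0 N) 2} {χ : MulChar (ZMod p) ℚ_[p]} {ã : ℚ_[p]}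

/-- A character of order `e ∈ {3, 4, 6}` is not its own inverse. [folklore] -/
theorem inv_ne_self_of_orderOf_mem {e : ℕ} (he : e ∈ ({3, 4, 6} : Finset ℕ)) (hχe : orderOf χ = e) :
    χ⁻¹ ≠ χ := by
  intro h
  have h2 : χ ^ 2 = 1 := by
    rw [pow_two]
    nth_rw 1 [← h]
    exact inv_mul_cancel χ
  have hdvd : orderOf χ ∣ 2 := orderOf_dvd_of_pow_eq_one h2
  rw [hχe] at hdvd
  have hle : e ≤ 2 := Nat.le_of_dvd two_pos hdvd
  simp only [Finset.mem_insert, Finset.mem_singleton] at he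
  omega

/-- **EXISTENCE (Delbourgo 1998 Thm. 1): one of the two conjugate forced partners is tower-bounded.**
On the ADDITIVE locus at `p ≥ 5` with defect `e ∈ {3,4,6}`, for a (G)-field `F` (inside a `p`-th
cyclotomic field) with good ordinary reduction above `p`, a place `w ∣ p`, THE unit root `ã` of
`X² − a_w(E_F)X + p` and ANY character `χ` of order `e`: the forced partner of `(χ, ã)` or that of
`(χ⁻¹, ã)` is bounded on the tower (the fact's pair `(ε, α_p)` has `α_p = ã` by uniqueness of the
unit root and `ε ∈ {χ, χ⁻¹}` since `φ(e) = 2`; its rows force tower boundedness,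
`towerBounded_forced_of_measure`). Which one is NOT asserted. Nothing booked.
[cite: Delbourgo1998, Theorem 1 (p. 131), p. 130, pp. 132–133]
[cite: MazurTateTeitelbaum1986Invent, §I.10] -/
theorem towerBounded_forced_or_inv_of_thm1 (hD : Delbourgo1998.thm1_exists_bounded_evenMeasure)
    (h5 : 5 ≤ p) (hadd : Addv W p) (he : semistabilityIndex W p ∈ ({3, 4, 6} : Finset ℕ))
    (hf : IsNewformOf W f)
    {L : Type} [Field L] [NumberField L] [IsCyclotomicExtension {p} ℚ L] (F : IntermediateField ℚ L)
    (hF : ∀ w : HeightOneSpectrum (𝓞 F), (p : 𝓞 F) ∈ w.asIdeal →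
      (W.baseChange F).HasGoodReductionAt w ∧ (W.baseChange F).HasUnitRootAt w)
    (w : HeightOneSpectrum (𝓞 F)) (hw : (p : 𝓞 F) ∈ w.asIdeal)
    (hã : ‖ã‖ = 1) (hroot : ã ^ 2 - (((W.baseChange F).frobeniusTraceAt w : ℤ) : ℚ_[p]) * ã + p = 0)
    (hχe : orderOf χ = semistabilityIndex W p) :
    (∃ C₀ : ℝ, ∀ (n : ℕ) (a : ℤ),
        ‖forced χ (fun r ↦ ((ratPlusSymbol f r : ℚ) : ℚ_[p])) ã ((a : ℚ) / (p : ℚ) ^ n)‖ ≤ C₀) ∨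
      ∃ C₁ : ℝ, ∀ (n : ℕ) (a : ℤ),
        ‖forced χ⁻¹ (fun r ↦ ((ratPlusSymbol f r : ℚ) : ℚ_[p])) ã ((a : ℚ) / (p : ℚ) ^ n)‖ ≤ C₁ := by
  obtain ⟨ε, a, μ, hord, ha, hroot', ⟨C', hbd⟩, hdist, hW, hT0, hT1, hTε⟩ :=
    hD W p h5 hadd he L F hF w hw f hf
  obtain rfl : a = ã := eq_of_unit_root hã ha hroot hroot'
  have hε1 : ε ≠ 1 := by
    intro h
    rw [h, orderOf_one] at hord
    simp only [Finset.mem_insert, Finset.mem_singleton, semistabilityIndex] at he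
    omega
  have hU0 := sum_ratPlusSymbol_add_div_eq_zero_of_addv W hf hadd
  obtain ⟨C₀, hC₀⟩ := towerBounded_forced_of_measure hε1 hã hU0 hbd hdist hW hT0 hT1 hTε
  rcases eq_or_eq_inv_of_orderOf_eq he hχe (hord.trans rfl) with rfl | rfl
  · exact Or.inl ⟨C₀, hC₀⟩
  · exact Or.inr ⟨C₀, hC₀⟩

/-- **EXACTLY ONE (Delbourgo 1998 Thm. 1 + a non-vanishing datum).** In the setting of
`towerBounded_forced_or_inv_of_thm1`, with `[0]⁺_f ≠ 0` or one non-vanishing even wild twisted symbol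
sum: the forced partner of `(χ, ã)` is tower-bounded IFF that of `(χ⁻¹, ã)` is NOT. Nothing booked.
[cite: Delbourgo1998, Theorem 1 (p. 131), p. 130] [cite: MazurTateTeitelbaum1986Invent, §I.10–I.14] -/
theorem towerBounded_forced_iff_not_inv_of_thm1 (hD : Delbourgo1998.thm1_exists_bounded_evenMeasure)
    (h5 : 5 ≤ p) (hadd : Addv W p) (he : semistabilityIndex W p ∈ ({3, 4, 6} : Finset ℕ))
    (hf : IsNewformOf W f)
    {L : Type} [Field L] [NumberField L] [IsCyclotomicExtension {p} ℚ L] (F : IntermediateField ℚ L)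
    (hF : ∀ w : HeightOneSpectrum (𝓞 F), (p : 𝓞 F) ∈ w.asIdeal →
      (W.baseChange F).HasGoodReductionAt w ∧ (W.baseChange F).HasUnitRootAt w)
    (w : HeightOneSpectrum (𝓞 F)) (hw : (p : 𝓞 F) ∈ w.asIdeal)
    (hã : ‖ã‖ = 1) (hroot : ã ^ 2 - (((W.baseChange F).frobeniusTraceAt w : ℤ) : ℚ_[p]) * ã + p = 0)
    (hχe : orderOf χ = semistabilityIndex W p)
    (hND : ratPlusSymbol f 0 ≠ 0 ∨
      ∃ (m : ℕ) (κ : DirichletCharacter ℂ_[p] (p ^ m)), 2 ≤ m ∧ κ.IsPrimitive ∧ κ.Even ∧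
        (∃ j : ℕ, orderOf κ = p ^ j) ∧ ratTwistedSymbolSum f κ ≠ 0) :
    (∃ C₀ : ℝ, ∀ (n : ℕ) (a : ℤ),
        ‖forced χ (fun r ↦ ((ratPlusSymbol f r : ℚ) : ℚ_[p])) ã ((a : ℚ) / (p : ℚ) ^ n)‖ ≤ C₀) ↔
      ¬ ∃ C₁ : ℝ, ∀ (n : ℕ) (a : ℤ),
        ‖forced χ⁻¹ (fun r ↦ ((ratPlusSymbol f r : ℚ) : ℚ_[p])) ã ((a : ℚ) / (p : ℚ) ^ n)‖ ≤ C₁ := by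
  have hp2 : p ≠ 2 := by omega
  have hχ : χ⁻¹ ≠ χ := inv_ne_self_of_orderOf_mem he hχe
  have hU0 := sum_ratPlusSymbol_add_div_eq_zero_of_addv W hf hadd
  constructor
  · intro hbd hinv
    exact not_towerBounded_forced_and_inv_of_nonvanishing hp2 hχ hã hU0 hND ⟨hbd, hinv⟩
  · intro hinv
    exact (towerBounded_forced_or_inv_of_thm1 hD h5 hadd he hf F hF w hw hã hroot hχe).resolve_right
      hinv

/-- **THE SIGN CERTIFICATE IS SUFFICIENT AND NECESSARY (Delbourgo 1998 Thm. 1 + a non-vanishing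
datum).** In the setting of `towerBounded_forced_or_inv_of_thm1`, with a tower bound `C` of the plus
symbols `‖[a/pⁿ]⁺_f‖_p ≤ C`: the forced partner of `(χ, ã)` is tower-bounded IFF a SIGN CERTIFICATE
against `χ⁻¹` exists, `C < ‖forced χ⁻¹ [·]⁺_f ã (a₀/p^{n₀})‖_p` for some `n₀, a₀` (⟸ gen 25
`towerBounded_forced_of_thm1_of_signCert`; ⟹ `forall_exists_lt_norm_forced_inv_of_towerBounded`).
So gen 25's three finite per-pair data are COMPLETE on every row with a non-vanishing even twisted
value. Nothing booked. [cite: Delbourgo1998, Theorem 1 (p. 131), p. 130]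
[cite: MazurTateTeitelbaum1986Invent, §I.8, §I.10–I.14] -/
theorem towerBounded_forced_iff_exists_signCert_of_thm1
    (hD : Delbourgo1998.thm1_exists_bounded_evenMeasure)
    (h5 : 5 ≤ p) (hadd : Addv W p) (he : semistabilityIndex W p ∈ ({3, 4, 6} : Finset ℕ))
    (hf : IsNewformOf W f)
    {L : Type} [Field L] [NumberField L] [IsCyclotomicExtension {p} ℚ L] (F : IntermediateField ℚ L)
    (hF : ∀ w : HeightOneSpectrum (𝓞 F), (p : 𝓞 F) ∈ w.asIdeal →
      (W.baseChange F).HasGoodReductionAt w ∧ (W.baseChange F).HasUnitRootAt w)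
    (w : HeightOneSpectrum (𝓞 F)) (hw : (p : 𝓞 F) ∈ w.asIdeal)
    (hã : ‖ã‖ = 1) (hroot : ã ^ 2 - (((W.baseChange F).frobeniusTraceAt w : ℤ) : ℚ_[p]) * ã + p = 0)
    (hχe : orderOf χ = semistabilityIndex W p)
    (hND : ratPlusSymbol f 0 ≠ 0 ∨
      ∃ (m : ℕ) (κ : DirichletCharacter ℂ_[p] (p ^ m)), 2 ≤ m ∧ κ.IsPrimitive ∧ κ.Even ∧
        (∃ j : ℕ, orderOf κ = p ^ j) ∧ ratTwistedSymbolSum f κ ≠ 0)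
    {C : ℝ} (hC : ∀ (n : ℕ) (a : ℤ), ‖((ratPlusSymbol f ((a : ℚ) / (p : ℚ) ^ n) : ℚ) : ℚ_[p])‖ ≤ C) :
    (∃ C₀ : ℝ, ∀ (n : ℕ) (a : ℤ),
        ‖forced χ (fun r ↦ ((ratPlusSymbol f r : ℚ) : ℚ_[p])) ã ((a : ℚ) / (p : ℚ) ^ n)‖ ≤ C₀) ↔
      ∃ (n₀ : ℕ) (a₀ : ℤ),
        C < ‖forced χ⁻¹ (fun r ↦ ((ratPlusSymbol f r : ℚ) : ℚ_[p])) ã ((a₀ : ℚ) / (p : ℚ) ^ n₀)‖ := by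
  have hp2 : p ≠ 2 := by omega
  have hχ : χ⁻¹ ≠ χ := inv_ne_self_of_orderOf_mem he hχe
  have hU0 := sum_ratPlusSymbol_add_div_eq_zero_of_addv W hf hadd
  constructor
  · intro hbd
    exact forall_exists_lt_norm_forced_inv_of_towerBounded hp2 hχ hã hU0 hND hbd C
  · intro hsign
    exact towerBounded_forced_of_thm1_of_signCert hD h5 hadd he hf F hF w hw hã hroot hχe hC hsign

/-- **THE SIGN BIT IS DECIDABLE: of the two candidate sign certificates EXACTLY ONE exists**
(Delbourgo 1998 Thm. 1 + a non-vanishing datum; `C` a tower bound of the plus symbols). A certificate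
against `χ⁻¹` (`C < ‖forced χ⁻¹ … (a₀/p^{n₀})‖`) exists IFF no certificate against `χ` exists: ⟸ is
fact-free (no certificate against `χ` means `(χ, ã)` is tower-bounded by `C`, then
`forall_exists_lt_norm_forced_inv_of_towerBounded`); ⟹: both certificates would make BOTH partners
exceed the plus-symbol bound, but one of them is a genuine tower-bounded partner (the fact) and a
bounded partner never exceeds that bound (`norm_towerSup_le_of_twist_partner`). The census's
two-sided tower search (E-SIGNCERT) therefore TERMINATES and CANNOT ANSWER BOTH WAYS. Nothing booked.
[cite: Delbourgo1998, Theorem 1 (p. 131), p. 130] [cite: MazurTateTeitelbaum1986Invent, §I.8, §I.10] -/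
theorem exists_signCert_iff_not_exists_signCert_inv_of_thm1
    (hD : Delbourgo1998.thm1_exists_bounded_evenMeasure)
    (h5 : 5 ≤ p) (hadd : Addv W p) (he : semistabilityIndex W p ∈ ({3, 4, 6} : Finset ℕ))
    (hf : IsNewformOf W f)
    {L : Type} [Field L] [NumberField L] [IsCyclotomicExtension {p} ℚ L] (F : IntermediateField ℚ L)
    (hF : ∀ w : HeightOneSpectrum (𝓞 F), (p : 𝓞 F) ∈ w.asIdeal →
      (W.baseChange F).HasGoodReductionAt w ∧ (W.baseChange F).HasUnitRootAt w)
    (w : HeightOneSpectrum (𝓞 F)) (hw : (p : 𝓞 F) ∈ w.asIdeal)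
    (hã : ‖ã‖ = 1) (hroot : ã ^ 2 - (((W.baseChange F).frobeniusTraceAt w : ℤ) : ℚ_[p]) * ã + p = 0)
    (hχe : orderOf χ = semistabilityIndex W p)
    (hND : ratPlusSymbol f 0 ≠ 0 ∨
      ∃ (m : ℕ) (κ : DirichletCharacter ℂ_[p] (p ^ m)), 2 ≤ m ∧ κ.IsPrimitive ∧ κ.Even ∧
        (∃ j : ℕ, orderOf κ = p ^ j) ∧ ratTwistedSymbolSum f κ ≠ 0)
    {C : ℝ} (hC : ∀ (n : ℕ) (a : ℤ), ‖((ratPlusSymbol f ((a : ℚ) / (p : ℚ) ^ n) : ℚ) : ℚ_[p])‖ ≤ C) :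
    (∃ (n₀ : ℕ) (a₀ : ℤ),
        C < ‖forced χ⁻¹ (fun r ↦ ((ratPlusSymbol f r : ℚ) : ℚ_[p])) ã ((a₀ : ℚ) / (p : ℚ) ^ n₀)‖) ↔
      ¬ ∃ (n₀ : ℕ) (a₀ : ℤ),
        C < ‖forced χ (fun r ↦ ((ratPlusSymbol f r : ℚ) : ℚ_[p])) ã ((a₀ : ℚ) / (p : ℚ) ^ n₀)‖ := by
  have hp2 : p ≠ 2 := by omega
  have hχ : χ⁻¹ ≠ χ := inv_ne_self_of_orderOf_mem he hχe
  have hχ' : χ⁻¹⁻¹ ≠ χ⁻¹ := by rw [inv_inv]; exact hχ.symm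
  have hχe' : orderOf χ⁻¹ = semistabilityIndex W p := by rw [orderOf_inv, hχe]
  have hU0 := sum_ratPlusSymbol_add_div_eq_zero_of_addv W hf hadd
  constructor
  · rintro hsign hsign'
    -- both certificates ⟹ both partners tower-bounded (gen 25, applied to `χ` and to `χ⁻¹`)
    have hbd := towerBounded_forced_of_thm1_of_signCert hD h5 hadd he hf F hF w hw hã hroot hχe hC
      hsign
    have hbd' := towerBounded_forced_of_thm1_of_signCert hD h5 hadd he hf F hF w hw hã hroot hχe' hC
      (by rw [inv_inv]; exact hsign')
    exact not_towerBounded_forced_and_inv_of_nonvanishing hp2 hχ hã hU0 hND ⟨hbd, hbd'⟩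
  · intro hno
    push Not at hno
    exact forall_exists_lt_norm_forced_inv_of_towerBounded hp2 hχ hã hU0 hND ⟨C, hno⟩ C

end ExactlyOne

/-! ### §3 `L(E,1) ≠ 0` (census arm X4-3): the non-vanishing datum is automatic -/

section RankZero

variable {W : WeierstrassCurve ℚ} [W.IsElliptic] [W.IsGloballyMinimal] {p : ℕ} [hp : Fact p.Prime]
  {N : ℕ} [NeZero N] {f : CuspForm (Gamma0 N) 2} {χ : MulChar (ZMod p) ℚ_[p]} {ã : ℚ_[p]}

/-- **X4♯(G-ord), defect 3, 4, 6, `ord_{s=1}L(E,s) = 0`, `p ≥ 5`: THE SIGN BIT IS DECIDABLE WITH NO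
EXTRA INPUT.** For a (G)-field `F` with a place `w ∣ p`, THE unit root `ã` of `X² − a_w(E_F)X + p`
and a character `χ` of order `e`: a sign certificate against `χ⁻¹` at the Drinfeld–Manin bound `1`
(`1 < ‖forced χ⁻¹ [·]⁺_f ã (a₀/p^{n₀})‖_p`) exists IFF none against `χ` exists — from Delbourgo 1998
Thm. 1 (named fact), `L(E,1) ≠ 0` (the datum `[0]⁺_f ≠ 0`) and `p`-integrality of the plus symbols
on X4 (irreducible `E[p]`). On the census arm X4-3 the two-sided tower search decides the character
per pair. Nothing booked; X4♯(G-ord) stays CONSTRUCTION-SHAPED.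
[cite: Delbourgo1998, Theorem 1 (p. 131), p. 130] [cite: Manin1972, Cor. 3.6]
[cite: MazurTateTeitelbaum1986Invent, §I.8, §I.10] -/
theorem ClassX4Gord.exists_signCert_iff_not_exists_signCert_inv_rankZero_of_thm1
    (hD : Delbourgo1998.thm1_exists_bounded_evenMeasure) (hX : ClassX4Gord W p) (h5 : 5 ≤ p)
    (he : semistabilityIndex W p ∈ ({3, 4, 6} : Finset ℕ)) (hr : W.analyticRank = 0)
    (hf : IsNewformOf W f)
    {L : Type} [Field L] [NumberField L] [IsCyclotomicExtension {p} ℚ L] (F : IntermediateField ℚ L)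
    (hF : ∀ w : HeightOneSpectrum (𝓞 F), (p : 𝓞 F) ∈ w.asIdeal →
      (W.baseChange F).HasGoodReductionAt w ∧ (W.baseChange F).HasUnitRootAt w)
    (w : HeightOneSpectrum (𝓞 F)) (hw : (p : 𝓞 F) ∈ w.asIdeal)
    (hã : ‖ã‖ = 1) (hroot : ã ^ 2 - (((W.baseChange F).frobeniusTraceAt w : ℤ) : ℚ_[p]) * ã + p = 0)
    (hχe : orderOf χ = semistabilityIndex W p) :
    (∃ (n₀ : ℕ) (a₀ : ℤ),
        1 < ‖forced χ⁻¹ (fun r ↦ ((ratPlusSymbol f r : ℚ) : ℚ_[p])) ã ((a₀ : ℚ) / (p : ℚ) ^ n₀)‖) ↔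
      ¬ ∃ (n₀ : ℕ) (a₀ : ℤ),
        1 < ‖forced χ (fun r ↦ ((ratPlusSymbol f r : ℚ) : ℚ_[p])) ã ((a₀ : ℚ) / (p : ℚ) ^ n₀)‖ := by
  have hC : ∀ (n : ℕ) (a : ℤ),
      ‖((ratPlusSymbol f ((a : ℚ) / (p : ℚ) ^ n) : ℚ) : ℚ_[p])‖ ≤ (1 : ℝ) := fun n a ↦
    plusSymbolsPIntegralAt_of_classX4 W p hX.1 f hf _
  exact exists_signCert_iff_not_exists_signCert_inv_of_thm1 hD h5 hX.addv.2 he hf F hF w hw hã hroot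
    hχe (Or.inl (Supersingular.ratPlusSymbol_zero_ne_zero_of_analyticRank_eq_zero hf hr)) hC

/-- **X4♯(G-ord), defect 3, 4, 6, `ord_{s=1}L(E,s) = 0`, `p ≥ 5`: EXACTLY ONE of the conjugate
forced partners (with THE unit root) is tower-bounded** — Delbourgo 1998 Thm. 1 + `L(E,1) ≠ 0`; no
certificate, no further input. Nothing booked. [cite: Delbourgo1998, Theorem 1 (p. 131), p. 130]
[cite: MazurTateTeitelbaum1986Invent, §I.10–I.14] -/
theorem ClassX4Gord.towerBounded_forced_iff_not_inv_rankZero_of_thm1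
    (hD : Delbourgo1998.thm1_exists_bounded_evenMeasure) (hX : ClassX4Gord W p) (h5 : 5 ≤ p)
    (he : semistabilityIndex W p ∈ ({3, 4, 6} : Finset ℕ)) (hr : W.analyticRank = 0)
    (hf : IsNewformOf W f)
    {L : Type} [Field L] [NumberField L] [IsCyclotomicExtension {p} ℚ L] (F : IntermediateField ℚ L)
    (hF : ∀ w : HeightOneSpectrum (𝓞 F), (p : 𝓞 F) ∈ w.asIdeal →
      (W.baseChange F).HasGoodReductionAt w ∧ (W.baseChange F).HasUnitRootAt w)
    (w : HeightOneSpectrum (𝓞 F)) (hw : (p : 𝓞 F) ∈ w.asIdeal)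
    (hã : ‖ã‖ = 1) (hroot : ã ^ 2 - (((W.baseChange F).frobeniusTraceAt w : ℤ) : ℚ_[p]) * ã + p = 0)
    (hχe : orderOf χ = semistabilityIndex W p) :
    (∃ C₀ : ℝ, ∀ (n : ℕ) (a : ℤ),
        ‖forced χ (fun r ↦ ((ratPlusSymbol f r : ℚ) : ℚ_[p])) ã ((a : ℚ) / (p : ℚ) ^ n)‖ ≤ C₀) ↔
      ¬ ∃ C₁ : ℝ, ∀ (n : ℕ) (a : ℤ),
        ‖forced χ⁻¹ (fun r ↦ ((ratPlusSymbol f r : ℚ) : ℚ_[p])) ã ((a : ℚ) / (p : ℚ) ^ n)‖ ≤ C₁ :=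
  towerBounded_forced_iff_not_inv_of_thm1 hD h5 hX.addv.2 he hf F hF w hw hã hroot hχe
    (Or.inl (Supersingular.ratPlusSymbol_zero_ne_zero_of_analyticRank_eq_zero hf hr))

end RankZero

/-! ### §4 Delbourgo's character is WELL-DEFINED: the unique character of order `e` whose forced
partner (with THE unit root) is tower-bounded -/

section Unique

variable {W : WeierstrassCurve ℚ} [W.IsElliptic] [W.IsGloballyMinimal] {p : ℕ} [hp : Fact p.Prime]
  {N : ℕ} [NeZero N] {f : CuspForm (Gamma0 N) 2} {ã : ℚ_[p]}

/-- **DELBOURGO'S CHARACTER IS WELL-DEFINED (Delbourgo 1998 Thm. 1 + a non-vanishing datum).** On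
the ADDITIVE locus at `p ≥ 5` with defect `e ∈ {3,4,6}`, for a (G)-field `F` with a place `w ∣ p` and
THE unit root `ã` of `X² − a_w(E_F)X + p`: given `[0]⁺_f ≠ 0` or one non-vanishing even wild twisted
symbol sum, there is EXACTLY ONE Dirichlet character `χ₀` mod `p` (values in `ℚ_p`) of order `e` whose
forced partner `forced χ₀ [·]⁺_f ã` is bounded on the tower — print's `ε` ("`f ⊗ ε̄` is `𝔭`-ordinary",
chosen on p. 130 "if not, twist by `ε` instead of `ε⁻¹`") is thereby characterised INTRINSICALLY by
`E`'s own plus symbols and the unit root, with no newform of nebentypus. Existence: the fact's pair;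
uniqueness: the two characters of order `e` are `χ₀^{±1}` and at most one conjugate partner is
tower-bounded (`not_towerBounded_forced_and_inv_of_nonvanishing`). Which power of the Teichmüller
character `χ₀` is, is NOT asserted (census dictionary `ω^{t(E,p)}` = EVIDENCE). Nothing booked.
[cite: Delbourgo1998, Theorem 1 (p. 131), §1.3 Lemma (p. 127), p. 130]
[cite: MazurTateTeitelbaum1986Invent, §I.10–I.14] -/
theorem existsUnique_towerBounded_forced_of_thm1 (hD : Delbourgo1998.thm1_exists_bounded_evenMeasure)
    (h5 : 5 ≤ p) (hadd : Addv W p) (he : semistabilityIndex W p ∈ ({3, 4, 6} : Finset ℕ))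
    (hf : IsNewformOf W f)
    {L : Type} [Field L] [NumberField L] [IsCyclotomicExtension {p} ℚ L] (F : IntermediateField ℚ L)
    (hF : ∀ w : HeightOneSpectrum (𝓞 F), (p : 𝓞 F) ∈ w.asIdeal →
      (W.baseChange F).HasGoodReductionAt w ∧ (W.baseChange F).HasUnitRootAt w)
    (w : HeightOneSpectrum (𝓞 F)) (hw : (p : 𝓞 F) ∈ w.asIdeal)
    (hã : ‖ã‖ = 1) (hroot : ã ^ 2 - (((W.baseChange F).frobeniusTraceAt w : ℤ) : ℚ_[p]) * ã + p = 0)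
    (hND : ratPlusSymbol f 0 ≠ 0 ∨
      ∃ (m : ℕ) (κ : DirichletCharacter ℂ_[p] (p ^ m)), 2 ≤ m ∧ κ.IsPrimitive ∧ κ.Even ∧
        (∃ j : ℕ, orderOf κ = p ^ j) ∧ ratTwistedSymbolSum f κ ≠ 0) :
    ∃! χ₀ : MulChar (ZMod p) ℚ_[p], orderOf χ₀ = semistabilityIndex W p ∧
      ∃ C₀ : ℝ, ∀ (n : ℕ) (a : ℤ),
        ‖forced χ₀ (fun r ↦ ((ratPlusSymbol f r : ℚ) : ℚ_[p])) ã ((a : ℚ) / (p : ℚ) ^ n)‖ ≤ C₀ := by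
  have hp2 : p ≠ 2 := by omega
  obtain ⟨ε, a, μ, hord, ha, hroot', ⟨C', hbd⟩, hdist, hW, hT0, hT1, hTε⟩ :=
    hD W p h5 hadd he L F hF w hw f hf
  obtain rfl : a = ã := eq_of_unit_root hã ha hroot hroot'
  have hord' : orderOf ε = semistabilityIndex W p := hord.trans rfl
  have hε1 : ε ≠ 1 := by
    intro h
    rw [h, orderOf_one] at hord'
    simp only [Finset.mem_insert, Finset.mem_singleton] at he
    omega
  have hU0 := sum_ratPlusSymbol_add_div_eq_zero_of_addv W hf hadd
  obtain ⟨C₀, hC₀⟩ := towerBounded_forced_of_measure hε1 hã hU0 hbd hdist hW hT0 hT1 hTε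
  refine ⟨ε, ⟨hord', C₀, hC₀⟩, ?_⟩
  rintro ψ ⟨hψe, hψbd⟩
  rcases eq_or_eq_inv_of_orderOf_eq he hord' hψe with rfl | rfl
  · rfl
  · exfalso
    exact not_towerBounded_forced_and_inv_of_nonvanishing hp2 (inv_ne_self_of_orderOf_mem he hord')
      hã hU0 hND ⟨⟨C₀, hC₀⟩, hψbd⟩

/-- **X4♯(G-ord), defect 3, 4, 6, `ord_{s=1}L(E,s) = 0`, `p ≥ 5`: Delbourgo's character is
well-defined with NO extra input** — exactly one character of order `e` has a tower-bounded forced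
partner with THE unit root (Delbourgo 1998 Thm. 1 + `L(E,1) ≠ 0`). Nothing booked; X4♯(G-ord)
CONSTRUCTION-SHAPED. [cite: Delbourgo1998, Theorem 1 (p. 131), p. 130]
[cite: MazurTateTeitelbaum1986Invent, §I.10–I.14] -/
theorem ClassX4Gord.existsUnique_towerBounded_forced_rankZero_of_thm1
    (hD : Delbourgo1998.thm1_exists_bounded_evenMeasure) (hX : ClassX4Gord W p) (h5 : 5 ≤ p)
    (he : semistabilityIndex W p ∈ ({3, 4, 6} : Finset ℕ)) (hr : W.analyticRank = 0)
    (hf : IsNewformOf W f)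
    {L : Type} [Field L] [NumberField L] [IsCyclotomicExtension {p} ℚ L] (F : IntermediateField ℚ L)
    (hF : ∀ w : HeightOneSpectrum (𝓞 F), (p : 𝓞 F) ∈ w.asIdeal →
      (W.baseChange F).HasGoodReductionAt w ∧ (W.baseChange F).HasUnitRootAt w)
    (w : HeightOneSpectrum (𝓞 F)) (hw : (p : 𝓞 F) ∈ w.asIdeal)
    (hã : ‖ã‖ = 1) (hroot : ã ^ 2 - (((W.baseChange F).frobeniusTraceAt w : ℤ) : ℚ_[p]) * ã + p = 0) :
    ∃! χ₀ : MulChar (ZMod p) ℚ_[p], orderOf χ₀ = semistabilityIndex W p ∧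
      ∃ C₀ : ℝ, ∀ (n : ℕ) (a : ℤ),
        ‖forced χ₀ (fun r ↦ ((ratPlusSymbol f r : ℚ) : ℚ_[p])) ã ((a : ℚ) / (p : ℚ) ^ n)‖ ≤ C₀ :=
  existsUnique_towerBounded_forced_of_thm1 hD h5 hX.addv.2 he hf F hF w hw hã hroot
    (Or.inl (Supersingular.ratPlusSymbol_zero_ne_zero_of_analyticRank_eq_zero hf hr))

end Unique

end TwistPartner

end Summit.BirchSwinnertonDyer.Rank1Residual.Additive

end
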